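import Mathlib

/-!
# The `K₅` typed-positivity certificate of (ii) = (RV) and of (i), in the kernel
(blind cell PercRepro2, typer-1 g9; lead g24 00:25:36Z «the K₅ certificate in Lean»; mine-1 g17 00:22:31Z
TYPED POSITIVITY: the Bernstein coefficients of the cleared cross-term halves are nonnegative on `K₅`)

Configurations of `K₅` on the marks `o = 0, a₁ = 1, a₂ = 2, a₃ = 3, b = 4` are `ω : Fin 10 → Bool`
(edge `e` = the `e`-th pair in lexicographic order, `ea e < eb e`).  Connectivity is computed on vertex
BITMASKS (`nb`, `step`, `reach`, `conn`: four closure steps, `Nat.testBit` / `Nat.lor` /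
`Nat.shiftLeft`, all kernel-accelerated); the eight event tables of the cleared (ii)
`N = P(ABO)P(Q)P(PD) + P(QB)P(PDoU)P(A) − P(QB)P(AO)P(PD) − P(AB)P(PDoU)P(Q)`
(`J1RV.rvTableExpr`; `Q = {a₁ ↮ a₂}`, `A = Q ∩ {a₃ ∈ C₁}`, `PD = Q ∩ {a₃ ∉ C₁ ∪ C₂}`, `PDoU = PD ∩ {o ∈ C₁ ∪ C₂}`,
`B = {b ∈ C₂}`, `O = {o ∈ C₂}`) and of the cleared (i) (`b ∈ C₁` in place of `b ∈ C₂`) are Boolean functions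
of `ω`.

**Kronecker substitution.**  `kron T = Σ_ω [T ω] · KB^{idx ω}` with `idx ω = Σ_e ω_e 4^e` and `KB = 2^20`
(computed by the edge-tree recursion `go`, which keeps the kernel's memory small);
a product of three encodings is the encoding of the degree-3 Bernstein coefficients (the signed
triple counts — `K5Bernstein.lean`).  So the two numbers
`kPos = kron ABO · kron Q · kron PD + kron QB · kron PDoU · kron A` and
`kNeg = kron QB · kron AO · kron PD + kron AB · kron PDoU · kron Q` carry, digit by digit (base `KB`,
digit `idx₄ k` for the profile `k ∈ {0,1,2,3}^10`), the positive and the negative parts of every coefficient;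
the coefficients are `≤ 2 · 3^10 < 2^17`.

**The certificate** (`cert_ii`, one `decide +kernel`, ≈ 20 s): `kNeg ≤ kPos`, `Nat.land (kPos − kNeg) mask = 0`,
`Nat.land kNeg mask = 0` (`Nat.land` spelled out: the kernel accelerates it on literals), where `mask` has bit `19` of every base-`KB` digit set.  Digits of `kNeg` and of the
difference below `2^19` means the subtraction borrowed nowhere, i.e. `kPos ≥ kNeg` DIGITWISE: every Bernstein
coefficient of `N` is `≥ 0`.  `cert_i` is the same for (i) (`kPos₁ ≤ kNeg₁` digitwise).  No `native_decide`,
no data file: the kernel computes the tables, the products and the masks itself.  The bridge from these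
`ℕ` facts to `CaseOne.RV` / `CaseOne.ZSplitI` on `K₅` for every weight vector is in `K5Conn.lean`,
`K5Bernstein.lean`, `K5Theorem.lean`.
-/

namespace Summit.Ventures.PercRepro2

namespace K5

/-! ## The graph `K₅` on the five marks and bitmask connectivity -/

/-- First endpoint of edge `e` (lexicographic pairs). -/
def ea : Fin 10 → ℕ
  | 0 => 0 | 1 => 0 | 2 => 0 | 3 => 0 | 4 => 1 | 5 => 1 | 6 => 1 | 7 => 2 | 8 => 2 | 9 => 3

/-- Second endpoint of edge `e`. -/
def eb : Fin 10 → ℕ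
  | 0 => 1 | 1 => 2 | 2 => 3 | 3 => 4 | 4 => 2 | 5 => 3 | 6 => 4 | 7 => 3 | 8 => 4 | 9 => 4

/-- The neighbour bitmask of the vertex `u` in the open subgraph of `ω`. -/
def nb (ω : Fin 10 → Bool) (u : ℕ) : ℕ :=
  (List.finRange 10).foldl (fun acc e =>
    if ω e then
      (if ea e = u then acc ||| (1 <<< eb e) else if eb e = u then acc ||| (1 <<< ea e) else acc)
    else acc) 0

/-- One closure step on a vertex bitmask: add the open neighbours of every vertex of `R`. -/
def step (ω : Fin 10 → Bool) (R : ℕ) : ℕ :=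
  (List.range 5).foldl (fun acc v => if R.testBit v then acc ||| nb ω v else acc) R

/-- The vertices reached from `u` (four steps suffice on five vertices). -/
def reach (ω : Fin 10 → Bool) (u : ℕ) : ℕ := step ω (step ω (step ω (step ω (1 <<< u))))

/-- Computable connectivity `u ↔ v` in the open subgraph of `ω`. -/
def conn (ω : Fin 10 → Bool) (u v : ℕ) : Bool := (reach ω u).testBit v

/-! ## The event tables -/

/-- `Q = {a₁ ↮ a₂}`. -/
def tQ (ω : Fin 10 → Bool) : Bool := !conn ω 1 2
/-- `A = Q ∩ {a₃ ∈ C₁}` (the case-1 world `T′`). -/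
def tA (ω : Fin 10 → Bool) : Bool := tQ ω && conn ω 1 3
/-- `PD = Q ∩ {a₃ ∉ C₁ ∪ C₂}`. -/
def tPD (ω : Fin 10 → Bool) : Bool := tQ ω && !conn ω 1 3 && !conn ω 2 3
/-- `PD ∩ {o ∈ C₁ ∪ C₂}` (its mass is `D_o`). -/
def tPDoU (ω : Fin 10 → Bool) : Bool := tPD ω && (conn ω 1 0 || conn ω 2 0)
/-- `Q ∩ {b ∈ C₂}`. -/
def tQB (ω : Fin 10 → Bool) : Bool := tQ ω && conn ω 2 4
/-- `A ∩ {o ∈ C₂}`. -/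
def tAO (ω : Fin 10 → Bool) : Bool := tA ω && conn ω 2 0
/-- `A ∩ {b ∈ C₂}`. -/
def tAB (ω : Fin 10 → Bool) : Bool := tA ω && conn ω 2 4
/-- `A ∩ {b ∈ C₂} ∩ {o ∈ C₂}`. -/
def tABO (ω : Fin 10 → Bool) : Bool := tA ω && conn ω 2 4 && conn ω 2 0
/-- `Q ∩ {b ∈ C₁}` (the (i) side). -/
def tQBL (ω : Fin 10 → Bool) : Bool := tQ ω && conn ω 1 4
/-- `A ∩ {b ∈ C₁}`. -/
def tABL (ω : Fin 10 → Bool) : Bool := tA ω && conn ω 1 4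
/-- `A ∩ {b ∈ C₁} ∩ {o ∈ C₂}`. -/
def tABOL (ω : Fin 10 → Bool) : Bool := tA ω && conn ω 1 4 && conn ω 2 0

/-! ## Kronecker numbers and the certificates -/

/-- The base-4 index of a configuration: digit `e` is the state of edge `e`. -/
def idx (ω : Fin 10 → Bool) : ℕ := ∑ e, (ω e).toNat * 4 ^ (e : ℕ)

/-- The Kronecker base `2^20` (coefficients are `< 2^17`). -/
def KB : ℕ := 2 ^ 20

/-- The Kronecker encoding of a Boolean table on the configurations, as a finite sum
(the mathematical form: `K5Bernstein.lean` regroups products of three of them). -/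
def kronSum (T : (Fin 10 → Bool) → Bool) : ℕ := ∑ ω, (T ω).toNat * KB ^ idx ω

/-- The same number by a binary tree over the edges `9, 8, …, 0` (`go T n ω` sums over the states of the
edges `< n`, the others fixed by `ω`): `go T (n+1) ω = go T n ω[n ↦ 0] + KB^{4^n} · go T n ω[n ↦ 1]`.
The kernel evaluates this with `≈ 10 MB` of intermediate numbers (the 1024-term sum would keep
`2.5 GB` of cached partial sums). -/
def go (T : (Fin 10 → Bool) → Bool) : ℕ → (Fin 10 → Bool) → ℕ
  | 0, ω => (T ω).toNat
  | n + 1, ω => go T n (Function.update ω (Fin.ofNat 10 n) false) +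
      KB ^ (4 ^ n) * go T n (Function.update ω (Fin.ofNat 10 n) true)

/-- The Kronecker encoding, kernel form: `kron T = go T 10 (fun _ => false)` (`= kronSum T`,
`K5Bernstein.kron_eq_kronSum`). -/
def kron (T : (Fin 10 → Bool) → Bool) : ℕ := go T 10 (fun _ => false)

/-- The positive part of the cleared (ii): `kron ABO · kron Q · kron PD + kron QB · kron PDoU · kron A`. -/
def kPos : ℕ := kron tABO * kron tQ * kron tPD + kron tQB * kron tPDoU * kron tA

/-- The negative part of the cleared (ii): `kron QB · kron AO · kron PD + kron AB · kron PDoU · kron Q`. -/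
def kNeg : ℕ := kron tQB * kron tAO * kron tPD + kron tAB * kron tPDoU * kron tQ

/-- The positive part of the cleared (i): `kron ABOL · kron Q · kron PD + kron QBL · kron PDoU · kron A`. -/
def kPos₁ : ℕ := kron tABOL * kron tQ * kron tPD + kron tQBL * kron tPDoU * kron tA

/-- The negative part of the cleared (i): `kron QBL · kron AO · kron PD + kron ABL · kron PDoU · kron Q`. -/
def kNeg₁ : ℕ := kron tQBL * kron tAO * kron tPD + kron tABL * kron tPDoU * kron tQ

/-- The mask: bit `19` of every base-`KB` digit below `4^10`. -/
def mask : ℕ := 2 ^ 19 * ((KB ^ (4 ^ 10) - 1) / (KB - 1))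

set_option maxRecDepth 100000 in
/-- **The `K₅` certificate of (ii)** — every Bernstein coefficient of the cleared (ii) is `≥ 0`:
`kPos ≥ kNeg` digitwise, witnessed by `kNeg ≤ kPos` and the two mask tests (no borrow anywhere). -/
theorem cert_ii : kNeg ≤ kPos ∧ Nat.land (kPos - kNeg) mask = 0 ∧ Nat.land kNeg mask = 0 := by
  decide +kernel

set_option maxRecDepth 100000 in
/-- **The `K₅` certificate of (i)** — every Bernstein coefficient of the cleared (i) is `≤ 0`:
`kPos₁ ≤ kNeg₁` digitwise. -/
theorem cert_i : kPos₁ ≤ kNeg₁ ∧ Nat.land (kNeg₁ - kPos₁) mask = 0 ∧ Nat.land kPos₁ mask = 0 := by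
  decide +kernel

end K5

end Summit.Ventures.PercRepro2
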